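import Summits.Ventures.GridStability.Bench.KUNDUR2ACSGDeg4AOwnVDeg4Nu4ibk3m1Pp
import Summits.Ventures.GridStability.Lyapunov.CertificateSoundness
import Summits.Ventures.GridStability.Lyapunov.PolyRecastKeyedLie
import Summits.Ventures.GridStability.Lyapunov.PolyRecastEval
import Mathlib.Analysis.Calculus.Deriv.Pi
import Mathlib.Analysis.Normed.Module.FiniteDimension
import HarnessLib

/-!
# #50-roa — «G2.a-K2A-alg-deg4»-roa (recast half): from the kernel-checked OWN-V DEGREE-4 certificate
# `Bench/KUNDUR2ACSGDeg4AOwnVDeg4Nu4ibk3m1Pp` (toolchain A, level 3/28) to invariance, no pole slip and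
# attraction of the certified sublevel piece FOR THE RECAST two-area MODEL M′

Venture GRIDFUSION, cell `gridfusion`, `plan/PARTITION.md` A2 (alg / roa), A5 (bridge), A6 (arc rule); lead g6 RULING 7t
(1)(C) 2026-08-27T13:17:55Z «#50-roa … so that #50's L box is an ROA theorem, not only a certificate»; seat
gridfusion-lyap-2 (g3), generator `gen_k2a4.py` = lyap-1's `gen6.py` template (#22 `KUNDUR2ACSGDeg2AOwnVNu4ibk3m1PpRoa`
p507108 / #62 `WSCC9Deg4ASosgramDinstRoa`) with TWO substitutions: (1) `V` has 534 monomials (no `_V_eq` lemma), so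
continuity of `V` and `V(0) = 0` come from `Lyapunov/PolyRecastEval.lean` (p499980; one `decide` «no constant monomial»);
(2) the chain-rule link `V̇_poly = lieDeriv F V_poly` (1674 terms, 9669 raw products of the nine `∂_k V` (146–186 terms)
with the field components) is decided in KEY SPACE by `Lyapunov/PolyRecastKeyedLie.lean` (p526803, lyap-2 g2:
`PolyRecast.lieCheckK 16 9 3 1 ΛA ΛB F V (−V̇) 9`, ΛA = 10⁶ = lcm of the denominators of the `∂_k V`, ΛB = lcm of those
of `F` (41 digits); ONE `decide +kernel`, all arithmetic in `ℕ`) — the template's `SOS.Poly.lieDeriv` decide does not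
reduce at this size (cf. #62's seven-link split). Companion of sos-5 / sos-7's kernel set
`Bench/KUNDUR2ACSGDeg4AOwnVDeg4Nu4ibk3m1Pp{Data1–24, Psd1–4, Chk1–7, Win1–4, Twin*, Part1–4, }.lean` (A file of record
`cert/A/KUNDUR2A-CSG-deg4-A-ownV-deg4-nu4ibk3m1-pp.json`, file sha256 `36c09ec489f469d0…`, sos-1 kit j273425 = seeded exact
re-projection of sos-1's own-V deg-4 claim instance `2c6ce31d…`; V̇ side by the windowed-residual lane X3b
`GramSOSWindows`), whose decls it uses VERBATIM (`deg4_A_ownV_deg4_nu4ibk3m1_pp_{f_<var>, h1, h2, h3, V, Vdot}` + `_poly` /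
`_eq`, and the six CERTIFIED identities `…_{V_pos, Vdot_neg, level_in_ball, arc_excl_kappa_2, arc_excl_kappa_11,
arc_excl_kappa_12}`). READ BACK before filing (`gen_k2a4.py`, exact stdlib `fractions`): the TREE literals `…_V_poly` (534
terms), `…_Vdot_poly_c0…c3` (1674), `…_f_<var>_poly`, `…_h{1,2,3}_poly` equal the A file's `lyapunov.V / Vdot`, `model.f / h`
term for term; `lieDeriv(F, V) = Vdot` EXACTLY; `lieDeriv(F, h_j) = 0`; `ΛA·ΛB·Vdot` integral; digit bounds 3 + 1 < 16.

THREE COLUMNS. CERTIFIED (kernel, in the Bench files): on `{h = 0}`: `V ≥ (1/17) φ_w`; on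
`{h = 0} ∩ {V ≤ 3/28} ∩ {φ_w ≤ 1}`: `V̇ ≤ −(1/2000) φ_w`; on `{h = 0} ∩ {V ≤ 3/28}`: `φ_w ≤ 1` and `κ₂, κ₁₁, κ₁₂ ≤ 1`,
with `φ_w = Σ(σ² + κ²) + Σν²/4` and the QUARTIC own-V `V` of the file. MODELLED: every theorem of THIS file is about the
recast polynomial system `ż = F(z)` on `{h₁ = h₂ = h₃ = 0} ⊂ ℝ⁹` — the TREE OBJECT `Kundur2A.csgPre.relField (1/10)`
(model-1 p466090 / p473726, literals `RecastLiteralsKundur2A.lean` p482037) = the relative-speed recast, w.r.t. the machine at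
bus 1, of the Chow–Sanchez-Gasca two-area four-machine classical model with constant-impedance loads (transfer conductances
kept), K rounded h12, scaled time `τ = t/√(2H/Ω)` with unit inertias, and the ASSUMED UNIFORM DAMPING RATIO `λ = 1/10` (printed
`D = 0`) — census label «synthetic uniform damping on the printed two-area network», never a sentence about the printed `D = 0`
system; `z = (σ₂, κ₂, σ₁₁, κ₁₁, σ₁₂, κ₁₂, ν₂, ν₁₁, ν₁₂)`, `σ = sin u`, `κ = 1 − cos u`, `u` = relative rotor-angle deviation
from the equilibrium, `ν` = relative speed; MODEL-VALIDITY token = model-2's KUNDUR2A-CSG block + MV-λ(1/10) (MV-2(pre-fault,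
lossy reduced) + MV-P + MV-h12 + MV-E). VALIDATED: nothing (the SDP data and margins are provenance of the Bench row, never the
claim). No sentence of this file says a machine or a grid is stable; «region of attraction» below means: the stated set of
initial conditions OF THE MODEL M′ is carried to the model's equilibrium. The return to machine angles and speeds
(`Kundur2A.csgPre.toModelRel (1/10) a′`, `Kundur2A.hasDerivWithinAt_embedRel`) is the sibling `…RoaModel.lean`.

STATEMENT (`deg4_A_ownV_deg4_nu4ibk3m1_pp_roa`): for every `0 < γ ≤ 3/28` and every solution `z` of the recast system on
`[0, ∞)` (Mathlib sense: continuous, right derivative `F (z t)`) with `z 0 ∈ M = {h₁ = h₂ = h₃ = 0}` and `V(z 0) ≤ γ`: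
`V(z t) ≤ γ` and `κ₂(t), κ₁₁(t), κ₁₂(t) ≤ 1` for all `t ≥ 0`, and `z t → 0`. Obligations: dissipation in bridge form
(`LVz_le`), `W = (1/2000) φ_w` positive definite (`eq_zero_of_Wz`, `Wz_pos`), compactness from `level_in_ball` (`‖z‖∞ ≤ 2`),
the chain rule (keyed link) and the three first integrals via `PolyRecast`, then `Lyapunov.certificate_invariance_tendsto_univ`;
plus the gauge bound `(2000/17)·W ≤ V` on `M` (`phi_le_V`) for downstream RATE (`Lyapunov/CertificateDecay`) / inner-ball readings.
-/


namespace Summit.Ventures.GridStability.Bench.KUNDUR2ACSG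

open Set Filter Metric Topology Real
open Summit.Ventures.GridStability.Lyapunov
open Literature.Computation.Certificates Literature.Computation.Certificates.SOS

noncomputable section

/-! ### Recast phase space `Fin 9 → ℝ`, coordinates in the certificate's variable order ['sigma_2', 'kappa_2', 'sigma_11', 'kappa_11', 'sigma_12', 'kappa_12', 'nu_2', 'nu_11', 'nu_12'] -/

/-- The recast field of the instance on `Fin 9 → ℝ` (components = the Bench decls verbatim).
MODELLED column. [folklore] -/
def deg4_A_ownV_deg4_nu4ibk3m1_pp_F (z : Fin 9 → ℝ) : Fin 9 → ℝ :=
  ![deg4_A_ownV_deg4_nu4ibk3m1_pp_f_sigma_2 (z 0) (z 1) (z 2) (z 3) (z 4) (z 5) (z 6) (z 7) (z 8),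
    deg4_A_ownV_deg4_nu4ibk3m1_pp_f_kappa_2 (z 0) (z 1) (z 2) (z 3) (z 4) (z 5) (z 6) (z 7) (z 8),
    deg4_A_ownV_deg4_nu4ibk3m1_pp_f_sigma_11 (z 0) (z 1) (z 2) (z 3) (z 4) (z 5) (z 6) (z 7) (z 8),
    deg4_A_ownV_deg4_nu4ibk3m1_pp_f_kappa_11 (z 0) (z 1) (z 2) (z 3) (z 4) (z 5) (z 6) (z 7) (z 8),
    deg4_A_ownV_deg4_nu4ibk3m1_pp_f_sigma_12 (z 0) (z 1) (z 2) (z 3) (z 4) (z 5) (z 6) (z 7) (z 8),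
    deg4_A_ownV_deg4_nu4ibk3m1_pp_f_kappa_12 (z 0) (z 1) (z 2) (z 3) (z 4) (z 5) (z 6) (z 7) (z 8),
    deg4_A_ownV_deg4_nu4ibk3m1_pp_f_nu_2 (z 0) (z 1) (z 2) (z 3) (z 4) (z 5) (z 6) (z 7) (z 8),
    deg4_A_ownV_deg4_nu4ibk3m1_pp_f_nu_11 (z 0) (z 1) (z 2) (z 3) (z 4) (z 5) (z 6) (z 7) (z 8),
    deg4_A_ownV_deg4_nu4ibk3m1_pp_f_nu_12 (z 0) (z 1) (z 2) (z 3) (z 4) (z 5) (z 6) (z 7) (z 8)]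

/-- The certificate's `V` on the phase space. [folklore] -/
def deg4_A_ownV_deg4_nu4ibk3m1_pp_Vz (z : Fin 9 → ℝ) : ℝ := deg4_A_ownV_deg4_nu4ibk3m1_pp_V (z 0) (z 1) (z 2) (z 3) (z 4) (z 5) (z 6) (z 7) (z 8)

/-- Its Lie derivative `∇V·f` (the emitted `Vdot`). [folklore] -/
def deg4_A_ownV_deg4_nu4ibk3m1_pp_LVz (z : Fin 9 → ℝ) : ℝ := deg4_A_ownV_deg4_nu4ibk3m1_pp_Vdot (z 0) (z 1) (z 2) (z 3) (z 4) (z 5) (z 6) (z 7) (z 8)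

/-- The certified dissipation rate `W = ε_dot·φ`. [folklore] -/
def deg4_A_ownV_deg4_nu4ibk3m1_pp_Wz (z : Fin 9 → ℝ) : ℝ := ((1 : ℝ) / 2000) * ((1 : ℝ) * z 0 ^ 2 + (1 : ℝ) * z 1 ^ 2 + (1 : ℝ) * z 2 ^ 2 + (1 : ℝ) * z 3 ^ 2 + (1 : ℝ) * z 4 ^ 2 + (1 : ℝ) * z 5 ^ 2 + ((1 : ℝ) / 4) * z 6 ^ 2 + ((1 : ℝ) / 4) * z 7 ^ 2 + ((1 : ℝ) / 4) * z 8 ^ 2)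

/-- The recast constraint set `M = {h_j = 0}`. [folklore] -/
def deg4_A_ownV_deg4_nu4ibk3m1_pp_M : Set (Fin 9 → ℝ) := {z | deg4_A_ownV_deg4_nu4ibk3m1_pp_h1 (z 0) (z 1) (z 2) (z 3) (z 4) (z 5) (z 6) (z 7) (z 8) = 0 ∧ deg4_A_ownV_deg4_nu4ibk3m1_pp_h2 (z 0) (z 1) (z 2) (z 3) (z 4) (z 5) (z 6) (z 7) (z 8) = 0 ∧ deg4_A_ownV_deg4_nu4ibk3m1_pp_h3 (z 0) (z 1) (z 2) (z 3) (z 4) (z 5) (z 6) (z 7) (z 8) = 0}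

/-- The certificate's level `c = 3/28`. [folklore] -/
def deg4_A_ownV_deg4_nu4ibk3m1_pp_level : ℝ := ((3 : ℝ) / 28)

/-- Component `0` (`sigma_2`) of the recast field. [folklore] -/ @[simp] theorem deg4_A_ownV_deg4_nu4ibk3m1_pp_F_0 (z : Fin 9 → ℝ) : deg4_A_ownV_deg4_nu4ibk3m1_pp_F z 0 = deg4_A_ownV_deg4_nu4ibk3m1_pp_f_sigma_2 (z 0) (z 1) (z 2) (z 3) (z 4) (z 5) (z 6) (z 7) (z 8) := rfl
/-- Component `1` (`kappa_2`) of the recast field. [folklore] -/ @[simp] theorem deg4_A_ownV_deg4_nu4ibk3m1_pp_F_1 (z : Fin 9 → ℝ) : deg4_A_ownV_deg4_nu4ibk3m1_pp_F z 1 = deg4_A_ownV_deg4_nu4ibk3m1_pp_f_kappa_2 (z 0) (z 1) (z 2) (z 3) (z 4) (z 5) (z 6) (z 7) (z 8) := rfl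
/-- Component `2` (`sigma_11`) of the recast field. [folklore] -/ @[simp] theorem deg4_A_ownV_deg4_nu4ibk3m1_pp_F_2 (z : Fin 9 → ℝ) : deg4_A_ownV_deg4_nu4ibk3m1_pp_F z 2 = deg4_A_ownV_deg4_nu4ibk3m1_pp_f_sigma_11 (z 0) (z 1) (z 2) (z 3) (z 4) (z 5) (z 6) (z 7) (z 8) := rfl
/-- Component `3` (`kappa_11`) of the recast field. [folklore] -/ @[simp] theorem deg4_A_ownV_deg4_nu4ibk3m1_pp_F_3 (z : Fin 9 → ℝ) : deg4_A_ownV_deg4_nu4ibk3m1_pp_F z 3 = deg4_A_ownV_deg4_nu4ibk3m1_pp_f_kappa_11 (z 0) (z 1) (z 2) (z 3) (z 4) (z 5) (z 6) (z 7) (z 8) := rfl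
/-- Component `4` (`sigma_12`) of the recast field. [folklore] -/ @[simp] theorem deg4_A_ownV_deg4_nu4ibk3m1_pp_F_4 (z : Fin 9 → ℝ) : deg4_A_ownV_deg4_nu4ibk3m1_pp_F z 4 = deg4_A_ownV_deg4_nu4ibk3m1_pp_f_sigma_12 (z 0) (z 1) (z 2) (z 3) (z 4) (z 5) (z 6) (z 7) (z 8) := rfl
/-- Component `5` (`kappa_12`) of the recast field. [folklore] -/ @[simp] theorem deg4_A_ownV_deg4_nu4ibk3m1_pp_F_5 (z : Fin 9 → ℝ) : deg4_A_ownV_deg4_nu4ibk3m1_pp_F z 5 = deg4_A_ownV_deg4_nu4ibk3m1_pp_f_kappa_12 (z 0) (z 1) (z 2) (z 3) (z 4) (z 5) (z 6) (z 7) (z 8) := rfl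
/-- Component `6` (`nu_2`) of the recast field. [folklore] -/ @[simp] theorem deg4_A_ownV_deg4_nu4ibk3m1_pp_F_6 (z : Fin 9 → ℝ) : deg4_A_ownV_deg4_nu4ibk3m1_pp_F z 6 = deg4_A_ownV_deg4_nu4ibk3m1_pp_f_nu_2 (z 0) (z 1) (z 2) (z 3) (z 4) (z 5) (z 6) (z 7) (z 8) := rfl
/-- Component `7` (`nu_11`) of the recast field. [folklore] -/ @[simp] theorem deg4_A_ownV_deg4_nu4ibk3m1_pp_F_7 (z : Fin 9 → ℝ) : deg4_A_ownV_deg4_nu4ibk3m1_pp_F z 7 = deg4_A_ownV_deg4_nu4ibk3m1_pp_f_nu_11 (z 0) (z 1) (z 2) (z 3) (z 4) (z 5) (z 6) (z 7) (z 8) := rfl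
/-- Component `8` (`nu_12`) of the recast field. [folklore] -/ @[simp] theorem deg4_A_ownV_deg4_nu4ibk3m1_pp_F_8 (z : Fin 9 → ℝ) : deg4_A_ownV_deg4_nu4ibk3m1_pp_F z 8 = deg4_A_ownV_deg4_nu4ibk3m1_pp_f_nu_12 (z 0) (z 1) (z 2) (z 3) (z 4) (z 5) (z 6) (z 7) (z 8) := rfl

/-! ### `V` without an explicit `_V_eq` lemma (534 monomials): generic route `Lyapunov/PolyRecastEval.lean` -/

/-- `Vz` is the kernel polynomial `V_poly` read on the phase space through `vars (List.ofFn ·)`. [folklore] -/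
theorem deg4_A_ownV_deg4_nu4ibk3m1_pp_Vz_eq_eval (w : Fin 9 → ℝ) :
    deg4_A_ownV_deg4_nu4ibk3m1_pp_Vz w = Poly.eval (vars (List.ofFn w)) deg4_A_ownV_deg4_nu4ibk3m1_pp_V_poly := by
  simp [deg4_A_ownV_deg4_nu4ibk3m1_pp_Vz, deg4_A_ownV_deg4_nu4ibk3m1_pp_V]

/-- `V` is continuous on the phase space (`PolyRecast.continuous_eval_ofFn`). [folklore] -/
theorem deg4_A_ownV_deg4_nu4ibk3m1_pp_continuous_Vz : Continuous deg4_A_ownV_deg4_nu4ibk3m1_pp_Vz := by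
  have e : deg4_A_ownV_deg4_nu4ibk3m1_pp_Vz = fun w ↦ Poly.eval (vars (List.ofFn w)) deg4_A_ownV_deg4_nu4ibk3m1_pp_V_poly := by
    funext w; exact deg4_A_ownV_deg4_nu4ibk3m1_pp_Vz_eq_eval w
  rw [e]
  exact PolyRecast.continuous_eval_ofFn _

set_option maxRecDepth 100000 in
/-- Every monomial of `V_poly` has a nonzero exponent (no constant term; one kernel `decide` on the literal). [folklore] -/
theorem deg4_A_ownV_deg4_nu4ibk3m1_pp_V_noConst : (deg4_A_ownV_deg4_nu4ibk3m1_pp_V_poly.all fun t => t.1.any fun e => decide (e ≠ 0)) = true := by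
  decide +kernel

/-- `V(0) = 0` (`PolyRecast.eval_ofFn_zero_of_all`). [folklore] -/
theorem deg4_A_ownV_deg4_nu4ibk3m1_pp_Vz_zero : deg4_A_ownV_deg4_nu4ibk3m1_pp_Vz 0 = 0 := by
  rw [deg4_A_ownV_deg4_nu4ibk3m1_pp_Vz_eq_eval]
  exact PolyRecast.eval_ofFn_zero_of_all _ deg4_A_ownV_deg4_nu4ibk3m1_pp_V_noConst

/-! ### Algebraic consequences of the certified identities -/

/-- Dissipation inequality in bridge form on `M ∩ {V ≤ c}`: `LV ≤ −W` (the ball hypothesis of the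
Bench theorem discharged by `level_in_ball`). CERTIFIED inputs: `deg4_A_ownV_deg4_nu4ibk3m1_pp_Vdot_neg`, `deg4_A_ownV_deg4_nu4ibk3m1_pp_level_in_ball`. [folklore] -/
theorem deg4_A_ownV_deg4_nu4ibk3m1_pp_LVz_le {z : Fin 9 → ℝ} (hz : z ∈ deg4_A_ownV_deg4_nu4ibk3m1_pp_M) (hV : deg4_A_ownV_deg4_nu4ibk3m1_pp_Vz z ≤ deg4_A_ownV_deg4_nu4ibk3m1_pp_level) :
    deg4_A_ownV_deg4_nu4ibk3m1_pp_LVz z ≤ -deg4_A_ownV_deg4_nu4ibk3m1_pp_Wz z := by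
  have h := deg4_A_ownV_deg4_nu4ibk3m1_pp_Vdot_neg (z 0) (z 1) (z 2) (z 3) (z 4) (z 5) (z 6) (z 7) (z 8) hV (by have hb := deg4_A_ownV_deg4_nu4ibk3m1_pp_level_in_ball (z 0) (z 1) (z 2) (z 3) (z 4) (z 5) (z 6) (z 7) (z 8) hV hz.1 hz.2.1 hz.2.2; linarith) hz.1 hz.2.1 hz.2.2
  simp only [deg4_A_ownV_deg4_nu4ibk3m1_pp_LVz, deg4_A_ownV_deg4_nu4ibk3m1_pp_Wz]
  linarith

/-- `W = ε·φ` is positive definite: its only zero is the origin. [folklore] -/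
theorem deg4_A_ownV_deg4_nu4ibk3m1_pp_eq_zero_of_Wz {z : Fin 9 → ℝ} (hW : deg4_A_ownV_deg4_nu4ibk3m1_pp_Wz z = 0) : z = 0 := by
  simp only [deg4_A_ownV_deg4_nu4ibk3m1_pp_Wz] at hW
  have e0 : z 0 = 0 := (pow_eq_zero_iff two_ne_zero).mp (le_antisymm (by linarith [sq_nonneg (z 1), sq_nonneg (z 2), sq_nonneg (z 3), sq_nonneg (z 4), sq_nonneg (z 5), sq_nonneg (z 6), sq_nonneg (z 7), sq_nonneg (z 8)]) (sq_nonneg _))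
  have e1 : z 1 = 0 := (pow_eq_zero_iff two_ne_zero).mp (le_antisymm (by linarith [sq_nonneg (z 0), sq_nonneg (z 2), sq_nonneg (z 3), sq_nonneg (z 4), sq_nonneg (z 5), sq_nonneg (z 6), sq_nonneg (z 7), sq_nonneg (z 8)]) (sq_nonneg _))
  have e2 : z 2 = 0 := (pow_eq_zero_iff two_ne_zero).mp (le_antisymm (by linarith [sq_nonneg (z 0), sq_nonneg (z 1), sq_nonneg (z 3), sq_nonneg (z 4), sq_nonneg (z 5), sq_nonneg (z 6), sq_nonneg (z 7), sq_nonneg (z 8)]) (sq_nonneg _))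
  have e3 : z 3 = 0 := (pow_eq_zero_iff two_ne_zero).mp (le_antisymm (by linarith [sq_nonneg (z 0), sq_nonneg (z 1), sq_nonneg (z 2), sq_nonneg (z 4), sq_nonneg (z 5), sq_nonneg (z 6), sq_nonneg (z 7), sq_nonneg (z 8)]) (sq_nonneg _))
  have e4 : z 4 = 0 := (pow_eq_zero_iff two_ne_zero).mp (le_antisymm (by linarith [sq_nonneg (z 0), sq_nonneg (z 1), sq_nonneg (z 2), sq_nonneg (z 3), sq_nonneg (z 5), sq_nonneg (z 6), sq_nonneg (z 7), sq_nonneg (z 8)]) (sq_nonneg _))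
  have e5 : z 5 = 0 := (pow_eq_zero_iff two_ne_zero).mp (le_antisymm (by linarith [sq_nonneg (z 0), sq_nonneg (z 1), sq_nonneg (z 2), sq_nonneg (z 3), sq_nonneg (z 4), sq_nonneg (z 6), sq_nonneg (z 7), sq_nonneg (z 8)]) (sq_nonneg _))
  have e6 : z 6 = 0 := (pow_eq_zero_iff two_ne_zero).mp (le_antisymm (by linarith [sq_nonneg (z 0), sq_nonneg (z 1), sq_nonneg (z 2), sq_nonneg (z 3), sq_nonneg (z 4), sq_nonneg (z 5), sq_nonneg (z 7), sq_nonneg (z 8)]) (sq_nonneg _))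
  have e7 : z 7 = 0 := (pow_eq_zero_iff two_ne_zero).mp (le_antisymm (by linarith [sq_nonneg (z 0), sq_nonneg (z 1), sq_nonneg (z 2), sq_nonneg (z 3), sq_nonneg (z 4), sq_nonneg (z 5), sq_nonneg (z 6), sq_nonneg (z 8)]) (sq_nonneg _))
  have e8 : z 8 = 0 := (pow_eq_zero_iff two_ne_zero).mp (le_antisymm (by linarith [sq_nonneg (z 0), sq_nonneg (z 1), sq_nonneg (z 2), sq_nonneg (z 3), sq_nonneg (z 4), sq_nonneg (z 5), sq_nonneg (z 6), sq_nonneg (z 7)]) (sq_nonneg _))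
  funext i
  fin_cases i <;> simp [e0, e1, e2, e3, e4, e5, e6, e7, e8]

/-- Strictness on every level surface `{V = γ}`, `γ > 0`: `W > 0` there. [folklore] -/
theorem deg4_A_ownV_deg4_nu4ibk3m1_pp_Wz_pos {z : Fin 9 → ℝ} {γ : ℝ} (hγ0 : 0 < γ) (hV : deg4_A_ownV_deg4_nu4ibk3m1_pp_Vz z = γ) :
    0 < deg4_A_ownV_deg4_nu4ibk3m1_pp_Wz z := by
  have hW0 : 0 ≤ deg4_A_ownV_deg4_nu4ibk3m1_pp_Wz z := by simp only [deg4_A_ownV_deg4_nu4ibk3m1_pp_Wz]; positivity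
  rcases hW0.lt_or_eq with h | h
  · exact h
  · exfalso
    have hz0 := deg4_A_ownV_deg4_nu4ibk3m1_pp_eq_zero_of_Wz h.symm
    subst hz0
    rw [deg4_A_ownV_deg4_nu4ibk3m1_pp_Vz_zero] at hV
    linarith

/-- Arc exclusion (A6) on the certified piece: `kappa_2 ≤ 1`. CERTIFIED input: `deg4_A_ownV_deg4_nu4ibk3m1_pp_arc_excl_kappa_2`. [folklore] -/
theorem deg4_A_ownV_deg4_nu4ibk3m1_pp_arc_kappa_2 {z : Fin 9 → ℝ} (hz : z ∈ deg4_A_ownV_deg4_nu4ibk3m1_pp_M) (hV : deg4_A_ownV_deg4_nu4ibk3m1_pp_Vz z ≤ deg4_A_ownV_deg4_nu4ibk3m1_pp_level) :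
    z 1 ≤ (1 : ℝ) := by
  have h := deg4_A_ownV_deg4_nu4ibk3m1_pp_arc_excl_kappa_2 (z 0) (z 1) (z 2) (z 3) (z 4) (z 5) (z 6) (z 7) (z 8) hV hz.1 hz.2.1 hz.2.2
  linarith

/-- Arc exclusion (A6) on the certified piece: `kappa_11 ≤ 1`. CERTIFIED input: `deg4_A_ownV_deg4_nu4ibk3m1_pp_arc_excl_kappa_11`. [folklore] -/
theorem deg4_A_ownV_deg4_nu4ibk3m1_pp_arc_kappa_11 {z : Fin 9 → ℝ} (hz : z ∈ deg4_A_ownV_deg4_nu4ibk3m1_pp_M) (hV : deg4_A_ownV_deg4_nu4ibk3m1_pp_Vz z ≤ deg4_A_ownV_deg4_nu4ibk3m1_pp_level) :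
    z 3 ≤ (1 : ℝ) := by
  have h := deg4_A_ownV_deg4_nu4ibk3m1_pp_arc_excl_kappa_11 (z 0) (z 1) (z 2) (z 3) (z 4) (z 5) (z 6) (z 7) (z 8) hV hz.1 hz.2.1 hz.2.2
  linarith

/-- Arc exclusion (A6) on the certified piece: `kappa_12 ≤ 1`. CERTIFIED input: `deg4_A_ownV_deg4_nu4ibk3m1_pp_arc_excl_kappa_12`. [folklore] -/
theorem deg4_A_ownV_deg4_nu4ibk3m1_pp_arc_kappa_12 {z : Fin 9 → ℝ} (hz : z ∈ deg4_A_ownV_deg4_nu4ibk3m1_pp_M) (hV : deg4_A_ownV_deg4_nu4ibk3m1_pp_Vz z ≤ deg4_A_ownV_deg4_nu4ibk3m1_pp_level) :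
    z 5 ≤ (1 : ℝ) := by
  have h := deg4_A_ownV_deg4_nu4ibk3m1_pp_arc_excl_kappa_12 (z 0) (z 1) (z 2) (z 3) (z 4) (z 5) (z 6) (z 7) (z 8) hV hz.1 hz.2.1 hz.2.2
  linarith

/-- Compactness of the certified piece `S = {z ∈ M | V z ≤ c}` (closed; bounded by
`level_in_ball`: `φ ≤ 1`, hence `‖z‖∞ ≤ 2`). [folklore] -/
theorem deg4_A_ownV_deg4_nu4ibk3m1_pp_isCompact_S : IsCompact {z ∈ deg4_A_ownV_deg4_nu4ibk3m1_pp_M | deg4_A_ownV_deg4_nu4ibk3m1_pp_Vz z ≤ deg4_A_ownV_deg4_nu4ibk3m1_pp_level} := by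
  have hMc : IsClosed deg4_A_ownV_deg4_nu4ibk3m1_pp_M := by
    simp only [deg4_A_ownV_deg4_nu4ibk3m1_pp_M, deg4_A_ownV_deg4_nu4ibk3m1_pp_h1_eq, deg4_A_ownV_deg4_nu4ibk3m1_pp_h2_eq, deg4_A_ownV_deg4_nu4ibk3m1_pp_h3_eq]
    exact (isClosed_eq (by fun_prop) continuous_const).inter
      ((isClosed_eq (by fun_prop) continuous_const).inter
      (isClosed_eq (by fun_prop) continuous_const))
  have h := isCompact_sublevel_of_norm_le (D := univ) (c := deg4_A_ownV_deg4_nu4ibk3m1_pp_level) (R := (2 : ℝ)) hMc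
    isClosed_univ deg4_A_ownV_deg4_nu4ibk3m1_pp_continuous_Vz.continuousOn ?_
  · rwa [inter_univ] at h
  rintro z ⟨hz, -⟩ hV
  have hball := deg4_A_ownV_deg4_nu4ibk3m1_pp_level_in_ball (z 0) (z 1) (z 2) (z 3) (z 4) (z 5) (z 6) (z 7) (z 8) hV hz.1 hz.2.1 hz.2.2
  have hb0 : |z 0| ≤ (2 : ℝ) := abs_le.2 (abs_le_of_sq_le_sq' (by nlinarith [sq_nonneg (z 1), sq_nonneg (z 2), sq_nonneg (z 3), sq_nonneg (z 4), sq_nonneg (z 5), sq_nonneg (z 6), sq_nonneg (z 7), sq_nonneg (z 8)]) (by norm_num))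
  have hb1 : |z 1| ≤ (2 : ℝ) := abs_le.2 (abs_le_of_sq_le_sq' (by nlinarith [sq_nonneg (z 0), sq_nonneg (z 2), sq_nonneg (z 3), sq_nonneg (z 4), sq_nonneg (z 5), sq_nonneg (z 6), sq_nonneg (z 7), sq_nonneg (z 8)]) (by norm_num))
  have hb2 : |z 2| ≤ (2 : ℝ) := abs_le.2 (abs_le_of_sq_le_sq' (by nlinarith [sq_nonneg (z 0), sq_nonneg (z 1), sq_nonneg (z 3), sq_nonneg (z 4), sq_nonneg (z 5), sq_nonneg (z 6), sq_nonneg (z 7), sq_nonneg (z 8)]) (by norm_num))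
  have hb3 : |z 3| ≤ (2 : ℝ) := abs_le.2 (abs_le_of_sq_le_sq' (by nlinarith [sq_nonneg (z 0), sq_nonneg (z 1), sq_nonneg (z 2), sq_nonneg (z 4), sq_nonneg (z 5), sq_nonneg (z 6), sq_nonneg (z 7), sq_nonneg (z 8)]) (by norm_num))
  have hb4 : |z 4| ≤ (2 : ℝ) := abs_le.2 (abs_le_of_sq_le_sq' (by nlinarith [sq_nonneg (z 0), sq_nonneg (z 1), sq_nonneg (z 2), sq_nonneg (z 3), sq_nonneg (z 5), sq_nonneg (z 6), sq_nonneg (z 7), sq_nonneg (z 8)]) (by norm_num))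
  have hb5 : |z 5| ≤ (2 : ℝ) := abs_le.2 (abs_le_of_sq_le_sq' (by nlinarith [sq_nonneg (z 0), sq_nonneg (z 1), sq_nonneg (z 2), sq_nonneg (z 3), sq_nonneg (z 4), sq_nonneg (z 6), sq_nonneg (z 7), sq_nonneg (z 8)]) (by norm_num))
  have hb6 : |z 6| ≤ (2 : ℝ) := abs_le.2 (abs_le_of_sq_le_sq' (by nlinarith [sq_nonneg (z 0), sq_nonneg (z 1), sq_nonneg (z 2), sq_nonneg (z 3), sq_nonneg (z 4), sq_nonneg (z 5), sq_nonneg (z 7), sq_nonneg (z 8)]) (by norm_num))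
  have hb7 : |z 7| ≤ (2 : ℝ) := abs_le.2 (abs_le_of_sq_le_sq' (by nlinarith [sq_nonneg (z 0), sq_nonneg (z 1), sq_nonneg (z 2), sq_nonneg (z 3), sq_nonneg (z 4), sq_nonneg (z 5), sq_nonneg (z 6), sq_nonneg (z 8)]) (by norm_num))
  have hb8 : |z 8| ≤ (2 : ℝ) := abs_le.2 (abs_le_of_sq_le_sq' (by nlinarith [sq_nonneg (z 0), sq_nonneg (z 1), sq_nonneg (z 2), sq_nonneg (z 3), sq_nonneg (z 4), sq_nonneg (z 5), sq_nonneg (z 6), sq_nonneg (z 7)]) (by norm_num))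
  refine (pi_norm_le_iff_of_nonneg (by norm_num)).2 fun i ↦ ?_
  rw [Real.norm_eq_abs]
  fin_cases i
  · simpa using hb0
  · simpa using hb1
  · simpa using hb2
  · simpa using hb3
  · simpa using hb4
  · simpa using hb5
  · simpa using hb6
  · simpa using hb7
  · simpa using hb8

/-! ### Calculus along a solution of the recast system (keyed Lie link `Lyapunov/PolyRecastKeyedLie.lean`) -/

/-- The recast field as the list of its `Poly` literals (the Bench decls, in coordinate order). [folklore] -/
def deg4_A_ownV_deg4_nu4ibk3m1_pp_Flit : List Poly := [deg4_A_ownV_deg4_nu4ibk3m1_pp_f_sigma_2_poly, deg4_A_ownV_deg4_nu4ibk3m1_pp_f_kappa_2_poly, deg4_A_ownV_deg4_nu4ibk3m1_pp_f_sigma_11_poly, deg4_A_ownV_deg4_nu4ibk3m1_pp_f_kappa_11_poly, deg4_A_ownV_deg4_nu4ibk3m1_pp_f_sigma_12_poly, deg4_A_ownV_deg4_nu4ibk3m1_pp_f_kappa_12_poly, deg4_A_ownV_deg4_nu4ibk3m1_pp_f_nu_2_poly, deg4_A_ownV_deg4_nu4ibk3m1_pp_f_nu_11_poly, deg4_A_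ownV_deg4_nu4ibk3m1_pp_f_nu_12_poly]

/-- `V` has 9 variables (`numVars` = longest exponent vector; one `decide`). [folklore] -/
theorem deg4_A_ownV_deg4_nu4ibk3m1_pp_V_numVars : Poly.numVars deg4_A_ownV_deg4_nu4ibk3m1_pp_V_poly = 9 := by decide +kernel

/-- The two integer scalings are positive: `ΛA` (7 digits) clears the denominators of every `∂_k V`,
`ΛB` (41 digits) those of every field component; `ΛA·ΛB` clears those of `V̇`. [folklore] -/
theorem deg4_A_ownV_deg4_nu4ibk3m1_pp_scalings_pos : 0 < 1000000 * 15599834200757322608614975405000000000000 := by norm_num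

set_option maxRecDepth 100000 in
/-- **The certificate's `Vdot` polynomial IS the Lie derivative of `V` along `f`**, decided in KEY SPACE
(`PolyRecast.lieCheckK`, base-16 Kronecker keys, sign–magnitude integer coefficients, digit bounds 3 + 1 < 16):
the 9669 products `(ΛA·∂_k V) × (ΛB·F_k)` (k = 0 … 8) and the 1674 terms of `ΛA·ΛB·(−V̇)` merge-sort into key
groups that all sum to ZERO — i.e. `lieDeriv F V = −(−V̇) = V̇` as polynomial functions
(`eval_lieDeriv_eq_neg_of_lieCheckK`). ONE `decide +kernel`, all arithmetic in `ℕ`. [folklore] -/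
theorem deg4_A_ownV_deg4_nu4ibk3m1_pp_vdot_linkK :
    PolyRecast.lieCheckK 16 9 3 1 1000000 15599834200757322608614975405000000000000 deg4_A_ownV_deg4_nu4ibk3m1_pp_Flit deg4_A_ownV_deg4_nu4ibk3m1_pp_V_poly (Poly.neg deg4_A_ownV_deg4_nu4ibk3m1_pp_Vdot_poly) 9 = true := by
  decide +kernel

/-- Coordinatewise form of a solution of the recast system, in the `PolyRecast` vocabulary. [folklore] -/
theorem deg4_A_ownV_deg4_nu4ibk3m1_pp_hasDerivWithinAt_coord {z : ℝ → Fin 9 → ℝ} {t : ℝ} {s : Set ℝ}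
    (hz : HasDerivWithinAt z (deg4_A_ownV_deg4_nu4ibk3m1_pp_F (z t)) s t) (i : Fin 9) :
    HasDerivWithinAt (fun τ ↦ z τ i)
      (Poly.eval (vars (List.ofFn (z t))) (deg4_A_ownV_deg4_nu4ibk3m1_pp_Flit.getD i [])) s t := by
  have h := (hasDerivWithinAt_pi.1 hz) i
  fin_cases i <;> simpa [deg4_A_ownV_deg4_nu4ibk3m1_pp_Flit, deg4_A_ownV_deg4_nu4ibk3m1_pp_F, deg4_A_ownV_deg4_nu4ibk3m1_pp_f_sigma_2, deg4_A_ownV_deg4_nu4ibk3m1_pp_f_kappa_2, deg4_A_ownV_deg4_nu4ibk3m1_pp_f_sigma_11, deg4_A_ownV_deg4_nu4ibk3m1_pp_f_kappa_11, deg4_A_ownV_deg4_nu4ibk3m1_pp_f_sigma_12, deg4_A_ownV_deg4_nu4ibk3m1_pp_f_kappa_12, deg4_A_ownV_deg4_nu4ibk3m1_pp_f_nu_2, deg4_A_ownV_deg4_nu4ibk3m1_pp_f_nu_11, deg4_A_ownV_deg4_nu4ibk3m1_pp_f_nu_12] using h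

/-- **Chain rule**: along a curve with right derivative `F (z t)`, `V ∘ z` has derivative
`LV (z t) = Vdot(z t)` (`PolyRecast.hasDerivWithinAt_eval_neg_of_lieCheckK` with `Rp := −V̇_poly`). [folklore] -/
theorem deg4_A_ownV_deg4_nu4ibk3m1_pp_hasDerivWithinAt_Vz {z : ℝ → Fin 9 → ℝ} {t : ℝ} {s : Set ℝ}
    (hz : HasDerivWithinAt z (deg4_A_ownV_deg4_nu4ibk3m1_pp_F (z t)) s t) :
    HasDerivWithinAt (deg4_A_ownV_deg4_nu4ibk3m1_pp_Vz ∘ z) (deg4_A_ownV_deg4_nu4ibk3m1_pp_LVz (z t)) s t := by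
  have h := PolyRecast.hasDerivWithinAt_eval_neg_of_lieCheckK (Fp := deg4_A_ownV_deg4_nu4ibk3m1_pp_Flit) (N' := 9)
    (by simp [deg4_A_ownV_deg4_nu4ibk3m1_pp_Flit]) deg4_A_ownV_deg4_nu4ibk3m1_pp_vdot_linkK deg4_A_ownV_deg4_nu4ibk3m1_pp_V_numVars deg4_A_ownV_deg4_nu4ibk3m1_pp_scalings_pos
    (deg4_A_ownV_deg4_nu4ibk3m1_pp_hasDerivWithinAt_coord hz)
  have e1 : deg4_A_ownV_deg4_nu4ibk3m1_pp_Vz ∘ z = fun τ ↦ Poly.eval (vars (List.ofFn (z τ))) deg4_A_ownV_deg4_nu4ibk3m1_pp_V_poly := by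
    funext τ; simp [deg4_A_ownV_deg4_nu4ibk3m1_pp_Vz, deg4_A_ownV_deg4_nu4ibk3m1_pp_V]
  have e2 : deg4_A_ownV_deg4_nu4ibk3m1_pp_LVz (z t) = -Poly.eval (vars (List.ofFn (z t))) (Poly.neg deg4_A_ownV_deg4_nu4ibk3m1_pp_Vdot_poly) := by
    rw [Poly.eval_neg, neg_neg]
    simp [deg4_A_ownV_deg4_nu4ibk3m1_pp_LVz, deg4_A_ownV_deg4_nu4ibk3m1_pp_Vdot]
  rw [e1, e2]
  exact h

/-- `deg4_A_ownV_deg4_nu4ibk3m1_pp_h1` has zero Lie derivative along `f` (one `decide`). [folklore] -/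
theorem deg4_A_ownV_deg4_nu4ibk3m1_pp_h1_isFirstIntegral : Poly.isZero (Poly.lieDeriv deg4_A_ownV_deg4_nu4ibk3m1_pp_Flit deg4_A_ownV_deg4_nu4ibk3m1_pp_h1_poly) = true := by
  decide +kernel

/-- **`deg4_A_ownV_deg4_nu4ibk3m1_pp_h1` is a first integral** of the recast field: `deg4_A_ownV_deg4_nu4ibk3m1_pp_h1 ∘ z` has right derivative `0`. [folklore] -/
theorem deg4_A_ownV_deg4_nu4ibk3m1_pp_hasDerivWithinAt_h1 {z : ℝ → Fin 9 → ℝ} {t : ℝ} {s : Set ℝ}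
    (hz : HasDerivWithinAt z (deg4_A_ownV_deg4_nu4ibk3m1_pp_F (z t)) s t) :
    HasDerivWithinAt (fun τ ↦ deg4_A_ownV_deg4_nu4ibk3m1_pp_h1 (z τ 0) (z τ 1) (z τ 2) (z τ 3) (z τ 4) (z τ 5) (z τ 6) (z τ 7) (z τ 8)) 0 s t := by
  have h := PolyRecast.hasDerivWithinAt_eval_zero_of_isZero (Fp := deg4_A_ownV_deg4_nu4ibk3m1_pp_Flit) (N := 9) (by simp [deg4_A_ownV_deg4_nu4ibk3m1_pp_Flit])
    deg4_A_ownV_deg4_nu4ibk3m1_pp_h1_isFirstIntegral (deg4_A_ownV_deg4_nu4ibk3m1_pp_hasDerivWithinAt_coord hz)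
  have e : (fun τ ↦ deg4_A_ownV_deg4_nu4ibk3m1_pp_h1 (z τ 0) (z τ 1) (z τ 2) (z τ 3) (z τ 4) (z τ 5) (z τ 6) (z τ 7) (z τ 8))
      = fun τ ↦ Poly.eval (vars (List.ofFn (z τ))) deg4_A_ownV_deg4_nu4ibk3m1_pp_h1_poly := by
    funext τ; simp [deg4_A_ownV_deg4_nu4ibk3m1_pp_h1]
  rw [e]
  exact h

/-- `deg4_A_ownV_deg4_nu4ibk3m1_pp_h2` has zero Lie derivative along `f` (one `decide`). [folklore] -/
theorem deg4_A_ownV_deg4_nu4ibk3m1_pp_h2_isFirstIntegral : Poly.isZero (Poly.lieDeriv deg4_A_ownV_deg4_nu4ibk3m1_pp_Flit deg4_A_ownV_deg4_nu4ibk3m1_pp_h2_poly) = true := by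
  decide +kernel

/-- **`deg4_A_ownV_deg4_nu4ibk3m1_pp_h2` is a first integral** of the recast field: `deg4_A_ownV_deg4_nu4ibk3m1_pp_h2 ∘ z` has right derivative `0`. [folklore] -/
theorem deg4_A_ownV_deg4_nu4ibk3m1_pp_hasDerivWithinAt_h2 {z : ℝ → Fin 9 → ℝ} {t : ℝ} {s : Set ℝ}
    (hz : HasDerivWithinAt z (deg4_A_ownV_deg4_nu4ibk3m1_pp_F (z t)) s t) :
    HasDerivWithinAt (fun τ ↦ deg4_A_ownV_deg4_nu4ibk3m1_pp_h2 (z τ 0) (z τ 1) (z τ 2) (z τ 3) (z τ 4) (z τ 5) (z τ 6) (z τ 7) (z τ 8)) 0 s t := by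
  have h := PolyRecast.hasDerivWithinAt_eval_zero_of_isZero (Fp := deg4_A_ownV_deg4_nu4ibk3m1_pp_Flit) (N := 9) (by simp [deg4_A_ownV_deg4_nu4ibk3m1_pp_Flit])
    deg4_A_ownV_deg4_nu4ibk3m1_pp_h2_isFirstIntegral (deg4_A_ownV_deg4_nu4ibk3m1_pp_hasDerivWithinAt_coord hz)
  have e : (fun τ ↦ deg4_A_ownV_deg4_nu4ibk3m1_pp_h2 (z τ 0) (z τ 1) (z τ 2) (z τ 3) (z τ 4) (z τ 5) (z τ 6) (z τ 7) (z τ 8))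
      = fun τ ↦ Poly.eval (vars (List.ofFn (z τ))) deg4_A_ownV_deg4_nu4ibk3m1_pp_h2_poly := by
    funext τ; simp [deg4_A_ownV_deg4_nu4ibk3m1_pp_h2]
  rw [e]
  exact h

/-- `deg4_A_ownV_deg4_nu4ibk3m1_pp_h3` has zero Lie derivative along `f` (one `decide`). [folklore] -/
theorem deg4_A_ownV_deg4_nu4ibk3m1_pp_h3_isFirstIntegral : Poly.isZero (Poly.lieDeriv deg4_A_ownV_deg4_nu4ibk3m1_pp_Flit deg4_A_ownV_deg4_nu4ibk3m1_pp_h3_poly) = true := by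
  decide +kernel

/-- **`deg4_A_ownV_deg4_nu4ibk3m1_pp_h3` is a first integral** of the recast field: `deg4_A_ownV_deg4_nu4ibk3m1_pp_h3 ∘ z` has right derivative `0`. [folklore] -/
theorem deg4_A_ownV_deg4_nu4ibk3m1_pp_hasDerivWithinAt_h3 {z : ℝ → Fin 9 → ℝ} {t : ℝ} {s : Set ℝ}
    (hz : HasDerivWithinAt z (deg4_A_ownV_deg4_nu4ibk3m1_pp_F (z t)) s t) :
    HasDerivWithinAt (fun τ ↦ deg4_A_ownV_deg4_nu4ibk3m1_pp_h3 (z τ 0) (z τ 1) (z τ 2) (z τ 3) (z τ 4) (z τ 5) (z τ 6) (z τ 7) (z τ 8)) 0 s t := by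
  have h := PolyRecast.hasDerivWithinAt_eval_zero_of_isZero (Fp := deg4_A_ownV_deg4_nu4ibk3m1_pp_Flit) (N := 9) (by simp [deg4_A_ownV_deg4_nu4ibk3m1_pp_Flit])
    deg4_A_ownV_deg4_nu4ibk3m1_pp_h3_isFirstIntegral (deg4_A_ownV_deg4_nu4ibk3m1_pp_hasDerivWithinAt_coord hz)
  have e : (fun τ ↦ deg4_A_ownV_deg4_nu4ibk3m1_pp_h3 (z τ 0) (z τ 1) (z τ 2) (z τ 3) (z τ 4) (z τ 5) (z τ 6) (z τ 7) (z τ 8))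
      = fun τ ↦ Poly.eval (vars (List.ofFn (z τ))) deg4_A_ownV_deg4_nu4ibk3m1_pp_h3_poly := by
    funext τ; simp [deg4_A_ownV_deg4_nu4ibk3m1_pp_h3]
  rw [e]
  exact h

/-- A solution of the recast system starting on `M` stays on `M` (the constraints are first
integrals). [folklore] -/
theorem deg4_A_ownV_deg4_nu4ibk3m1_pp_mem_M {z : ℝ → Fin 9 → ℝ} (hzc : ContinuousOn z (Ici 0))
    (hz : ∀ t, 0 ≤ t → HasDerivWithinAt z (deg4_A_ownV_deg4_nu4ibk3m1_pp_F (z t)) (Ici t) t)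
    (h0 : z 0 ∈ deg4_A_ownV_deg4_nu4ibk3m1_pp_M) : ∀ t, 0 ≤ t → z t ∈ deg4_A_ownV_deg4_nu4ibk3m1_pp_M := by
  intro T hT
  have hc0 : ContinuousOn (fun τ ↦ deg4_A_ownV_deg4_nu4ibk3m1_pp_h1 (z τ 0) (z τ 1) (z τ 2) (z τ 3) (z τ 4) (z τ 5) (z τ 6) (z τ 7) (z τ 8)) (Icc 0 T) := by
    have hc : Continuous fun y : Fin 9 → ℝ ↦ deg4_A_ownV_deg4_nu4ibk3m1_pp_h1 (y 0) (y 1) (y 2) (y 3) (y 4) (y 5) (y 6) (y 7) (y 8) := by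
      simp only [deg4_A_ownV_deg4_nu4ibk3m1_pp_h1_eq]; fun_prop
    exact hc.comp_continuousOn (hzc.mono fun s hs ↦ hs.1)
  have k0 := constant_of_has_deriv_right_zero hc0
    (fun t ht ↦ deg4_A_ownV_deg4_nu4ibk3m1_pp_hasDerivWithinAt_h1 (hz t ht.1)) T ⟨hT, le_rfl⟩
  have z0 : deg4_A_ownV_deg4_nu4ibk3m1_pp_h1 (z 0 0) (z 0 1) (z 0 2) (z 0 3) (z 0 4) (z 0 5) (z 0 6) (z 0 7) (z 0 8) = 0 := h0.1
  have hc1 : ContinuousOn (fun τ ↦ deg4_A_ownV_deg4_nu4ibk3m1_pp_h2 (z τ 0) (z τ 1) (z τ 2) (z τ 3) (z τ 4) (z τ 5) (z τ 6) (z τ 7) (z τ 8)) (Icc 0 T) := by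
    have hc : Continuous fun y : Fin 9 → ℝ ↦ deg4_A_ownV_deg4_nu4ibk3m1_pp_h2 (y 0) (y 1) (y 2) (y 3) (y 4) (y 5) (y 6) (y 7) (y 8) := by
      simp only [deg4_A_ownV_deg4_nu4ibk3m1_pp_h2_eq]; fun_prop
    exact hc.comp_continuousOn (hzc.mono fun s hs ↦ hs.1)
  have k1 := constant_of_has_deriv_right_zero hc1
    (fun t ht ↦ deg4_A_ownV_deg4_nu4ibk3m1_pp_hasDerivWithinAt_h2 (hz t ht.1)) T ⟨hT, le_rfl⟩
  have z1 : deg4_A_ownV_deg4_nu4ibk3m1_pp_h2 (z 0 0) (z 0 1) (z 0 2) (z 0 3) (z 0 4) (z 0 5) (z 0 6) (z 0 7) (z 0 8) = 0 := h0.2.1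
  have hc2 : ContinuousOn (fun τ ↦ deg4_A_ownV_deg4_nu4ibk3m1_pp_h3 (z τ 0) (z τ 1) (z τ 2) (z τ 3) (z τ 4) (z τ 5) (z τ 6) (z τ 7) (z τ 8)) (Icc 0 T) := by
    have hc : Continuous fun y : Fin 9 → ℝ ↦ deg4_A_ownV_deg4_nu4ibk3m1_pp_h3 (y 0) (y 1) (y 2) (y 3) (y 4) (y 5) (y 6) (y 7) (y 8) := by
      simp only [deg4_A_ownV_deg4_nu4ibk3m1_pp_h3_eq]; fun_prop
    exact hc.comp_continuousOn (hzc.mono fun s hs ↦ hs.1)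
  have k2 := constant_of_has_deriv_right_zero hc2
    (fun t ht ↦ deg4_A_ownV_deg4_nu4ibk3m1_pp_hasDerivWithinAt_h3 (hz t ht.1)) T ⟨hT, le_rfl⟩
  have z2 : deg4_A_ownV_deg4_nu4ibk3m1_pp_h3 (z 0 0) (z 0 1) (z 0 2) (z 0 3) (z 0 4) (z 0 5) (z 0 6) (z 0 7) (z 0 8) = 0 := h0.2.2
  exact ⟨by show deg4_A_ownV_deg4_nu4ibk3m1_pp_h1 (z T 0) (z T 1) (z T 2) (z T 3) (z T 4) (z T 5) (z T 6) (z T 7) (z T 8) = 0; rw [k0, z0], by show deg4_A_ownV_deg4_nu4ibk3m1_pp_h2 (z T 0) (z T 1) (z T 2) (z T 3) (z T 4) (z T 5) (z T 6) (z T 7) (z T 8) = 0; rw [k1, z1], by show deg4_A_ownV_deg4_nu4ibk3m1_pp_h3 (z T 0) (z T 1) (z T 2) (z T 3) (z T 4) (z T 5) (z T 6) (z T 7) (z T 8) = 0; rw [k2, z2]⟩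

/-! ### The ROA inclusion for the recast model -/

/-- **#50-roa, «G2.a-K2A-deg4»-roa (recast coordinates).** MODELLED: the recast polynomial system `ż = F(z)`
on `{h = 0} ⊂ ℝ⁹` of the instance (the TREE OBJECT `Kundur2A.csgPre.relField (1/10)`, interface I2;
MODEL-VALIDITY row of the Bench file). CERTIFIED inputs: the kernel-checked identities of the Bench file.
STATEMENT: for every level `0 < γ ≤ c = 3/28` and every solution `z` on `[0, ∞)` (Mathlib sense:
continuous, right derivative `F (z t)`) with `z 0 ∈ M`, `V(z 0) ≤ γ`: `V(z t) ≤ γ` and the arc bounds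
`κ₂, κ₁₁, κ₁₂ ≤ 1` for all `t ≥ 0`, and `z t → 0`. Via `Lyapunov.certificate_invariance_tendsto_univ`.
No sentence here says a machine or a grid is stable. [folklore] -/
theorem deg4_A_ownV_deg4_nu4ibk3m1_pp_roa {γ : ℝ} (hγ0 : 0 < γ) (hγ : γ ≤ deg4_A_ownV_deg4_nu4ibk3m1_pp_level) {z : ℝ → Fin 9 → ℝ}
    (hzc : ContinuousOn z (Ici 0))
    (hz : ∀ t, 0 ≤ t → HasDerivWithinAt z (deg4_A_ownV_deg4_nu4ibk3m1_pp_F (z t)) (Ici t) t)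
    (h0M : z 0 ∈ deg4_A_ownV_deg4_nu4ibk3m1_pp_M) (h0V : deg4_A_ownV_deg4_nu4ibk3m1_pp_Vz (z 0) ≤ γ) :
    (∀ t, 0 ≤ t → deg4_A_ownV_deg4_nu4ibk3m1_pp_Vz (z t) ≤ γ ∧ z t 1 ≤ (1 : ℝ) ∧ z t 3 ≤ (1 : ℝ) ∧ z t 5 ≤ (1 : ℝ)) ∧ Tendsto z atTop (𝓝 0) := by
  have hF : Continuous deg4_A_ownV_deg4_nu4ibk3m1_pp_F := by
    refine continuous_pi fun i ↦ ?_
    fin_cases i <;> simp [deg4_A_ownV_deg4_nu4ibk3m1_pp_F, deg4_A_ownV_deg4_nu4ibk3m1_pp_f_sigma_2_eq, deg4_A_ownV_deg4_nu4ibk3m1_pp_f_kappa_2_eq, deg4_A_ownV_deg4_nu4ibk3m1_pp_f_sigma_11_eq, deg4_A_ownV_deg4_nu4ibk3m1_pp_f_kappa_11_eq, deg4_A_ownV_deg4_nu4ibk3m1_pp_f_sigma_12_eq, deg4_A_ownV_deg4_nu4ibk3m1_pp_f_kappa_12_eq, deg4_A_ownV_deg4_nu4ibk3m1_pp_f_nu_2_eq,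 deg4_A_ownV_deg4_nu4ibk3m1_pp_f_nu_11_eq, deg4_A_ownV_deg4_nu4ibk3m1_pp_f_nu_12_eq] <;> fun_prop
  have hV : Continuous deg4_A_ownV_deg4_nu4ibk3m1_pp_Vz := deg4_A_ownV_deg4_nu4ibk3m1_pp_continuous_Vz
  have hW : Continuous deg4_A_ownV_deg4_nu4ibk3m1_pp_Wz := by unfold deg4_A_ownV_deg4_nu4ibk3m1_pp_Wz; fun_prop
  have h0 : (0 : Fin 9 → ℝ) ∈ deg4_A_ownV_deg4_nu4ibk3m1_pp_M := by simp [deg4_A_ownV_deg4_nu4ibk3m1_pp_M, deg4_A_ownV_deg4_nu4ibk3m1_pp_h1_eq, deg4_A_ownV_deg4_nu4ibk3m1_pp_h2_eq, deg4_A_ownV_deg4_nu4ibk3m1_pp_h3_eq]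
  have hMc : IsClosed deg4_A_ownV_deg4_nu4ibk3m1_pp_M := by
    simp only [deg4_A_ownV_deg4_nu4ibk3m1_pp_M, deg4_A_ownV_deg4_nu4ibk3m1_pp_h1_eq, deg4_A_ownV_deg4_nu4ibk3m1_pp_h2_eq, deg4_A_ownV_deg4_nu4ibk3m1_pp_h3_eq]
    exact (isClosed_eq (by fun_prop) continuous_const).inter
      ((isClosed_eq (by fun_prop) continuous_const).inter
      (isClosed_eq (by fun_prop) continuous_const))
  have hSγ : IsCompact {y ∈ deg4_A_ownV_deg4_nu4ibk3m1_pp_M | deg4_A_ownV_deg4_nu4ibk3m1_pp_Vz y ≤ γ} :=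
    deg4_A_ownV_deg4_nu4ibk3m1_pp_isCompact_S.of_isClosed_subset (hMc.inter (isClosed_le hV continuous_const))
      (fun y hy ↦ ⟨hy.1, hy.2.trans hγ⟩)
  have h := certificate_invariance_tendsto_univ (M := deg4_A_ownV_deg4_nu4ibk3m1_pp_M) (LV := deg4_A_ownV_deg4_nu4ibk3m1_pp_LVz) (W := deg4_A_ownV_deg4_nu4ibk3m1_pp_Wz)
    (x₀ := 0) hSγ hF.continuousOn hV.continuousOn hW.continuousOn
    (fun y hy hVy ↦ deg4_A_ownV_deg4_nu4ibk3m1_pp_LVz_le hy (hVy.trans hγ))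
    (fun y _ _ ↦ by simp only [deg4_A_ownV_deg4_nu4ibk3m1_pp_Wz]; positivity)
    (fun y _ hVy ↦ deg4_A_ownV_deg4_nu4ibk3m1_pp_Wz_pos hγ0 hVy)
    h0 (by rw [deg4_A_ownV_deg4_nu4ibk3m1_pp_Vz_zero]; exact hγ0.le) (by simp [deg4_A_ownV_deg4_nu4ibk3m1_pp_Wz])
    (fun y _ _ hWy ↦ deg4_A_ownV_deg4_nu4ibk3m1_pp_eq_zero_of_Wz hWy)
    hzc hz (fun t ht ↦ deg4_A_ownV_deg4_nu4ibk3m1_pp_hasDerivWithinAt_Vz (hz t ht)) (deg4_A_ownV_deg4_nu4ibk3m1_pp_mem_M hzc hz h0M) h0V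
  have hM := deg4_A_ownV_deg4_nu4ibk3m1_pp_mem_M hzc hz h0M
  exact ⟨fun t ht ↦ ⟨h.1 t ht, deg4_A_ownV_deg4_nu4ibk3m1_pp_arc_kappa_2 (hM t ht) ((h.1 t ht).trans hγ), deg4_A_ownV_deg4_nu4ibk3m1_pp_arc_kappa_11 (hM t ht) ((h.1 t ht).trans hγ), deg4_A_ownV_deg4_nu4ibk3m1_pp_arc_kappa_12 (hM t ht) ((h.1 t ht).trans hγ)⟩, h.2⟩

/-- **The certified lower bound `ε_pos·φ ≤ V` on `M`** in phase-space form (`ε_pos = 1/17`,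
`φ = Σ(σ² + κ²) + Σν²/4`): the positivity identity of the Bench file (`deg4_A_ownV_deg4_nu4ibk3m1_pp_V_pos`) — the gauge bound
consumed by `Lyapunov/CertificateDecay` for a future RATE rider and by any Euclidean inner-ball reading. [folklore] -/
theorem deg4_A_ownV_deg4_nu4ibk3m1_pp_phi_le_V {z : Fin 9 → ℝ} (hz : z ∈ deg4_A_ownV_deg4_nu4ibk3m1_pp_M) :
    ((2000 : ℝ) / 17) * deg4_A_ownV_deg4_nu4ibk3m1_pp_Wz z ≤ deg4_A_ownV_deg4_nu4ibk3m1_pp_Vz z := by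
  have h := deg4_A_ownV_deg4_nu4ibk3m1_pp_V_pos (z 0) (z 1) (z 2) (z 3) (z 4) (z 5) (z 6) (z 7) (z 8) hz.1 hz.2.1 hz.2.2
  simp only [deg4_A_ownV_deg4_nu4ibk3m1_pp_Wz, deg4_A_ownV_deg4_nu4ibk3m1_pp_Vz]
  linarith

end

end Summit.Ventures.GridStability.Bench.KUNDUR2ACSG
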